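import Summits.Parity.GeneralizedHardyLittlewood.Theses.LiouvilleMAD
import Summits.Parity.GeneralizedHardyLittlewood.Theses.LiouvilleShiftedTables
import Summits.Parity.GeneralizedHardyLittlewood.Theses.DicksonFibration
import Summits.Parity.GeneralizedHardyLittlewood.Theorems.LiouvilleMADEngineToGHL
import Summits.Parity.GeneralizedHardyLittlewood.Theorems.LiouvilleMADEngineToGHLStubRungWeights
import Summits.Parity.GeneralizedHardyLittlewood.Theorems.LiouvilleMADEngineToGHLStubRungEuler
import Summits.Parity.GeneralizedHardyLittlewood.Theorems.LiouvilleMADEngineToGHLStubRungLarge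
import Summits.Parity.GeneralizedHardyLittlewood.Theorems.LiouvilleMADEngineToGHLStubRungAssembly

/-!
# The tuple ladder for the crux `EngineToGHL` (stmt-Parity-14995, route LiouvilleMAD): the RUNG, proved

Line `tuple_ladder` (crux-strategist 2026-08-17; lead c5).  The crux is, with no hypothesis,
`EngineToGHL ↔ (PairsHL → DicksonFibration.DimOne)` (`engineToGHL_iff_pairsHL_imp_dimOne`).  The line climbs
from Hardy–Littlewood PAIRS to Hardy–Littlewood for ALL fixed unit-slope prime tuples by the route's own mechanism
one level up (Murty–Vatwani / Bombieri's asymptotic sieve on the adjoined form): for a `(t+1)`-set `H ∋ 0` expand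
`Λ(n + max H) = -∑_{d ∣ n + max H} μ(d) log d` against the tuple weight of `H' = H ∖ {max H}`, feed the small
divisors `d ≤ N^{1-δ}` to a relative tuple-Elliott–Halberstam hypothesis `Level(H')` (main term
`S_{H'}(N)·(-∑_{d ≤ D} μ(d) w(d) log d) → 𝔖(H)/𝔖(H')·S_{H'}(N)` by the singular-series identity), and the large
divisors, after `μ = λ·𝟙_sf`, to the Liouville tuple atoms `Atoms(H', max H)`.

This file PROVES the rung (`TupleLadder.tupleLadder_rung`, theorem-grade child `TupleLadder` of the prepared route
split, Cruxes/EngineToGHL/Lines/tuple_ladder.md) from the four landed pieces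
`TupleLadder.stub_rungWeights` (p138024), `stub_rungEuler` (p138333), `stub_rungLarge` (p139183, Aux p138987),
`stub_rungAssembly` (p138017), and records the glue of the split:

* `TupleLadder.tupleLadder_rung`      — THE RUNG: `HL(t) ∧ Level(t) ∧ Atoms(t) ⇒ HL(t+1)` for all `t ≥ 2`;
* `TupleLadder.hlTuples_of_pairsHL`   — `PairsHL ∧ TupleLevel ∧ TupleAtoms ⇒` Hardy–Littlewood in `Λ`-form for
  EVERY finite `H ∋ 0`, `#H ≥ 2` (induction on `#H`, base `PairsHL`);
* `engineToGHL_of_tupleLadder`         — the split glue `TupleLadder → TupleLevel → TupleAtoms → TuplesToDimOne →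
  EngineToGHL` (the planner's `--glue-by` constant);
* `engineToGHL_of_tupleInputs`         — the crux from the THREE conjecture-grade inputs alone (rung discharged):
  `TupleLevel → TupleAtoms → TuplesToDimOne → EngineToGHL`;
* `tuplesToDimOne_of_engineToGHL`      — the residual child is WEAKER than the crux.

For `H ⊆ ℕ` finite: `HL(H)` : `∑_{n ≤ N} ∏_{h ∈ H} Λ(n+h) = 𝔖(H)·N + o(N)`; `Level(H)` : relative tuple-EH for the
fixed tuple `H` at level `N^{1-δ}`, every `δ`, admissible classes equiprobable; `Atoms(H,h)` :
`∑_{q ≤ N^{ε₀}} |∑_{n ≤ y_q, n ≡ w_q (q)} λ(n+h) ∏_{h'∈H} Λ(n+h')| ≤ C N/(log N)^A`.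
-/

namespace Summit.Parity.GeneralizedHardyLittlewood.Theorems.EngineToGHL

open Summit.Parity.GeneralizedHardyLittlewood.Theses

/-- **The rung of the tuple ladder** (child `TupleLadder` of the split of `EngineToGHL`; Murty–Vatwani / Bombieri's
asymptotic sieve one level up).  For `t ≥ 2`: if Hardy–Littlewood holds in `Λ`-form on `[1,N]` for every `t`-set
`H' ∋ 0`, and for these `H'` the relative tuple-EH `Level(H')` and the atoms `Atoms(H', h)` (`h ∉ H'`) hold, then
Hardy–Littlewood holds for every `(t+1)`-set `H ∋ 0`.  Proof: `hs = max H ≥ 1` (`#H ≥ 3`), `H' = H ∖ {hs} ∋ 0`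
(`#H' = t`, all `h ∈ H'` are `< hs`); the weight arithmetic `stub_rungWeights` feeds the singular-series identity
`stub_rungEuler` (`-∑_{d≤D} μ w log → c`, `𝔖(H) = 𝔖(H')c`), the atoms give the large-divisor bound `stub_rungLarge`,
and `stub_rungAssembly` assembles `HL(insert hs H') = HL(H)`.
[cite: MurtyVatwani2017] [cite: Vatwani2016, §7.4] [cite: BombieriAsymptoticSieve1976] -/
theorem TupleLadder.tupleLadder_rung :
    ∀ t : ℕ, 2 ≤ t → (∀ H : Finset ℕ, 0 ∈ H → H.card = t → ((fun N : ℕ => ∑ n ∈ Finset.Icc 1 N, ∏ h ∈ H, ArithmeticFunction.vonMangoldt (n + h) - Literature.NumberTheory.Sieve.singularSeries ((H).image (fun h : ℕ => (h : ℤ))) * N) =o[Filter.atTop] fun N : ℕ => (N : ℝ))) → (∀ H : Finset ℕ, 0 ∈ H → H.card = t → (∀ δ : ℝ, 0 < δ → ∀ B : ℝ, ∃ C : ℝ, ∀ N : ℕ, 2 ≤ N → ∀ y r : ℕ → ℕ, (∀ d, y d ≤ N) → (∑ d ∈ Finset.Icc 1 ⌊(N : ℝ) ^ (1 - δ)⌋₊,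 |(∑ n ∈ (Finset.Icc 1 (y d)).filter (fun n : ℕ => n ≡ r d [MOD d]), ∏ h ∈ H, ArithmeticFunction.vonMangoldt (n + h)) - (if ∀ h ∈ H, Nat.Coprime (r d + h) d then (((Finset.range d).filter (fun ρ : ℕ => ∀ h ∈ H, Nat.Coprime (ρ + h) d)).card : ℝ)⁻¹ else 0) * ∑ n ∈ Finset.Icc 1 (y d), ∏ h ∈ H, ArithmeticFunction.vonMangoldt (n + h)|) ≤ C * N / Real.log N ^ B)) → (∀ (H : Finset ℕ) (h : ℕ), 0 ∈ H → H.card = t → h ∉ H → (∃ ε₀ : ℝ, 0 < ε₀ ∧ ∀ A : ℝ, 0 < A → ∃ C : ℝ, ∃ N₀ : ℕ, ∀ N : ℕ, N₀ ≤ N → ∀ w y : ℕ → ℕ, (∀ q, y q ≤ N) → (∑ q ∈ Finset.Icc 1 ⌊(N : ℝ) ^ ε₀⌋₊, |∑ n ∈ (Finset.Icc 1 (y q)).filter (fun n : ℕ => n ≡ w q [MOD q]), (ArithmeticFunction.liouville (n + h) : ℝ) * ∏ h' ∈ H, ArithmeticFunction.vonMangoldt (n + h')|) ≤ C * N / Real.log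 N ^ A)) → ∀ H : Finset ℕ, 0 ∈ H → H.card = t + 1 → ((fun N : ℕ => ∑ n ∈ Finset.Icc 1 N, ∏ h ∈ H, ArithmeticFunction.vonMangoldt (n + h) - Literature.NumberTheory.Sieve.singularSeries ((H).image (fun h : ℕ => (h : ℤ))) * N) =o[Filter.atTop] fun N : ℕ => (N : ℝ)) := by
  intro t ht hHL hLev hAt H h0 hcard
  have hne : H.Nonempty := ⟨0, h0⟩
  have hsH : H.max' hne ∈ H := H.max'_mem hne
  -- `hs = max H ≥ 1`: `H` has `t + 1 ≥ 3` elements, so it is not contained in `{0}`.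
  have hs1 : 1 ≤ H.max' hne := by
    by_contra hlt
    have h0max : H.max' hne = 0 := by omega
    have hsub : H ⊆ {0} := by
      intro x hx
      have hxle := H.le_max' x hx
      rw [h0max] at hxle
      simp [Nat.le_zero.mp hxle]
    have hcl := Finset.card_le_card hsub
    rw [Finset.card_singleton, hcard] at hcl
    omega
  have hnot : H.max' hne ∉ H.erase (H.max' hne) := Finset.notMem_erase _ _
  have h0' : 0 ∈ H.erase (H.max' hne) := Finset.mem_erase.mpr ⟨by omega, h0⟩
  have hcard' : (H.erase (H.max' hne)).card = t := by
    rw [Finset.card_erase_of_mem hsH, hcard]; rfl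
  have hlt : ∀ h ∈ H.erase (H.max' hne), h < H.max' hne := fun h hh =>
    lt_of_le_of_ne (H.le_max' h (Finset.mem_of_mem_erase hh)) (Finset.ne_of_mem_erase hh)
  obtain ⟨G, b, -, hbm, hG, hbμ, hbp, hW, hν, hνlt⟩ :=
    TupleLadder.stub_rungWeights (H.erase (H.max' hne)) (H.max' hne) hlt
  obtain ⟨c, hc, hT⟩ :=
    TupleLadder.stub_rungEuler (H.erase (H.max' hne)) (H.max' hne) hnot G b hbm hG hbμ hbp hW hν hνlt
  have hC := TupleLadder.stub_rungLarge (H.erase (H.max' hne)) (H.max' hne)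
    (hAt (H.erase (H.max' hne)) (H.max' hne) h0' hcard' hnot)
  have key := TupleLadder.stub_rungAssembly (H.erase (H.max' hne)) (H.max' hne) hnot
    (hHL _ h0' hcard') (hLev _ h0' hcard') ⟨c, hc, hT⟩ hC
  simp only [Finset.insert_erase hsH] at key
  exact key

/-- Base of the ladder: `PairsHL` is `HL(H)` for every `2`-set `H ∋ 0` (`H = {0, k}`, `k ≥ 1`,
`Finset.prod_pair`). [folklore] -/
theorem TupleLadder.hlTuple_pair_of_pairsHL (hP : LiouvilleShiftedTables.PairsHL) :
    ∀ H : Finset ℕ, 0 ∈ H → H.card = 2 → ((fun N : ℕ => ∑ n ∈ Finset.Icc 1 N, ∏ h ∈ H, ArithmeticFunction.vonMangoldt (n + h) - Literature.NumberTheory.Sieve.singularSeries ((H).image (fun h : ℕ => (h : ℤ))) * N) =o[Filter.atTop] fun N : ℕ => (N : ℝ)) := by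
  have key : ∀ k : ℕ, k ≠ 0 → ((fun N : ℕ => ∑ n ∈ Finset.Icc 1 N, ∏ h ∈ ({0, k} : Finset ℕ), ArithmeticFunction.vonMangoldt (n + h) - Literature.NumberTheory.Sieve.singularSeries ((({0, k} : Finset ℕ)).image (fun h : ℕ => (h : ℤ))) * N) =o[Filter.atTop] fun N : ℕ => (N : ℝ)) := by
    intro k hk
    have hk1 : 1 ≤ k := Nat.one_le_iff_ne_zero.mpr hk
    have h0k : (0 : ℕ) ≠ k := fun h => hk h.symm
    have himg : (({0, k} : Finset ℕ).image (fun h : ℕ => (h : ℤ))) = ({0, (k : ℤ)} : Finset ℤ) := by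
      simp [Finset.image_insert, Finset.image_singleton]
    have hprod : ∀ n : ℕ, ∏ h ∈ ({0, k} : Finset ℕ), ArithmeticFunction.vonMangoldt (n + h) =
        ArithmeticFunction.vonMangoldt n * ArithmeticFunction.vonMangoldt (n + k) := by
      intro n
      rw [Finset.prod_pair h0k, Nat.add_zero]
    simp only [hprod, himg]
    exact hP k hk1
  intro H h0 hcard
  obtain ⟨x, y, hxy, rfl⟩ := Finset.card_eq_two.mp hcard
  rcases Finset.mem_insert.mp h0 with hx | hy
  · subst hx
    exact key y (fun h => hxy h.symm)
  · rw [Finset.mem_singleton] at hy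
    subst hy
    rw [Finset.pair_comm]
    exact key x hxy

/-- **All fixed unit-slope prime tuples from pairs + the two tuple inputs.**  `PairsHL`, the relative tuple-EH
`TupleLevel` and the tuple atoms `TupleAtoms` give Hardy–Littlewood in `Λ`-form on `[1,N]` for EVERY finite
`H ∋ 0` with `#H ≥ 2` (induction on `#H` by the rung; base = pairs). [folklore] -/
theorem TupleLadder.hlTuples_of_pairsHL (hP : LiouvilleShiftedTables.PairsHL)
    (h2 : (∀ H : Finset ℕ, 0 ∈ H → 2 ≤ H.card → (∀ δ : ℝ, 0 < δ → ∀ B : ℝ, ∃ C : ℝ, ∀ N : ℕ, 2 ≤ N → ∀ y r : ℕ → ℕ, (∀ d, y d ≤ N) → (∑ d ∈ Finset.Icc 1 ⌊(N : ℝ) ^ (1 - δ)⌋₊, |(∑ n ∈ (Finset.Icc 1 (y d)).filter (fun n : ℕ => n ≡ r d [MOD d]), ∏ h ∈ H, ArithmeticFunction.vonMangoldt (n + h)) - (if ∀ h ∈ H, Nat.Coprime (r d + h) d then (((Finset.range d).filter (fun ρ : ℕ => ∀ h ∈ H, Nat.Coprime (ρ + h) d)).card : ℝ)⁻¹ else 0)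 * ∑ n ∈ Finset.Icc 1 (y d), ∏ h ∈ H, ArithmeticFunction.vonMangoldt (n + h)|) ≤ C * N / Real.log N ^ B)))
    (h3 : (∀ (H : Finset ℕ) (h : ℕ), 0 ∈ H → 2 ≤ H.card → h ∉ H → (∃ ε₀ : ℝ, 0 < ε₀ ∧ ∀ A : ℝ, 0 < A → ∃ C : ℝ, ∃ N₀ : ℕ, ∀ N : ℕ, N₀ ≤ N → ∀ w y : ℕ → ℕ, (∀ q, y q ≤ N) → (∑ q ∈ Finset.Icc 1 ⌊(N : ℝ) ^ ε₀⌋₊, |∑ n ∈ (Finset.Icc 1 (y q)).filter (fun n : ℕ => n ≡ w q [MOD q]), (ArithmeticFunction.liouville (n + h) : ℝ) * ∏ h' ∈ H, ArithmeticFunction.vonMangoldt (n + h')|) ≤ C * N / Real.log N ^ A))) :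
    ∀ H : Finset ℕ, 0 ∈ H → 2 ≤ H.card → ((fun N : ℕ => ∑ n ∈ Finset.Icc 1 N, ∏ h ∈ H, ArithmeticFunction.vonMangoldt (n + h) - Literature.NumberTheory.Sieve.singularSeries ((H).image (fun h : ℕ => (h : ℤ))) * N) =o[Filter.atTop] fun N : ℕ => (N : ℝ)) := by
  suffices hs : ∀ t : ℕ, 2 ≤ t → ∀ H : Finset ℕ, 0 ∈ H → H.card = t → ((fun N : ℕ => ∑ n ∈ Finset.Icc 1 N, ∏ h ∈ H, ArithmeticFunction.vonMangoldt (n + h) - Literature.NumberTheory.Sieve.singularSeries ((H).image (fun h : ℕ => (h : ℤ))) * N) =o[Filter.atTop] fun N : ℕ => (N : ℝ)) from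
    fun H h0 hc => hs H.card hc H h0 rfl
  intro t ht
  induction t, ht using Nat.le_induction with
  | base => exact TupleLadder.hlTuple_pair_of_pairsHL hP
  | succ t ht ih =>
      exact TupleLadder.tupleLadder_rung t ht ih (fun H h0 hc => h2 H h0 (hc ▸ ht))
        (fun H h h0 hc hh => h3 H h h0 (hc ▸ ht) hh)

/-- **Glue of the tuple-ladder split of `EngineToGHL`** (the four children `TupleLadder`, `TupleLevel`, `TupleAtoms`,
`TuplesToDimOne` of Cruxes/EngineToGHL/Lines/tuple_ladder.md, statements inline): the crux BY NAME from the four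
child statements — `engineToGHL_iff_pairsHL_imp_dimOne` + induction on `#H` from `PairsHL`.  This is the constant
for `route edit --split EngineToGHL --glue-by`. [folklore] -/
theorem engineToGHL_of_tupleLadder :
    (∀ t : ℕ, 2 ≤ t → (∀ H : Finset ℕ, 0 ∈ H → H.card = t → ((fun N : ℕ => ∑ n ∈ Finset.Icc 1 N, ∏ h ∈ H, ArithmeticFunction.vonMangoldt (n + h) - Literature.NumberTheory.Sieve.singularSeries ((H).image (fun h : ℕ => (h : ℤ))) * N) =o[Filter.atTop] fun N : ℕ => (N : ℝ))) → (∀ H : Finset ℕ, 0 ∈ H → H.card = t → (∀ δ : ℝ, 0 < δ → ∀ B : ℝ, ∃ C : ℝ, ∀ N : ℕ, 2 ≤ N → ∀ y r : ℕ → ℕ, (∀ d, y d ≤ N) → (∑ d ∈ Finset.Icc 1 ⌊(N : ℝ) ^ (1 - δ)⌋₊, |(∑ n ∈ (Finset.Icc 1 (y d)).filter (fun n : ℕ => n ≡ r d [MOD d]), ∏ h ∈ H, ArithmeticFunction.vonMangoldt (n + h)) - (if ∀ h ∈ H, Nat.Coprime (r d + h) d then (((Finset.range d).filter (fun ρ :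 ℕ => ∀ h ∈ H, Nat.Coprime (ρ + h) d)).card : ℝ)⁻¹ else 0) * ∑ n ∈ Finset.Icc 1 (y d), ∏ h ∈ H, ArithmeticFunction.vonMangoldt (n + h)|) ≤ C * N / Real.log N ^ B)) → (∀ (H : Finset ℕ) (h : ℕ), 0 ∈ H → H.card = t → h ∉ H → (∃ ε₀ : ℝ, 0 < ε₀ ∧ ∀ A : ℝ, 0 < A → ∃ C : ℝ, ∃ N₀ : ℕ, ∀ N : ℕ, N₀ ≤ N → ∀ w y : ℕ → ℕ, (∀ q, y q ≤ N) → (∑ q ∈ Finset.Icc 1 ⌊(N : ℝ) ^ ε₀⌋₊, |∑ n ∈ (Finset.Icc 1 (y q)).filter (fun n : ℕ => n ≡ w q [MOD q]), (ArithmeticFunction.liouville (n + h) : ℝ) * ∏ h' ∈ H, ArithmeticFunction.vonMangoldt (n + h')|) ≤ C * N / Real.log N ^ A)) → ∀ H : Finset ℕ, 0 ∈ H → H.card = t + 1 → ((fun N : ℕ => ∑ n ∈ Finset.Icc 1 N, ∏ h ∈ H, ArithmeticFunction.vonMangoldt (n + h) - Literature.NumberTheory.Sieve.singularSeries ((H).image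 (fun h : ℕ => (h : ℤ))) * N) =o[Filter.atTop] fun N : ℕ => (N : ℝ))) →
    (∀ H : Finset ℕ, 0 ∈ H → 2 ≤ H.card → (∀ δ : ℝ, 0 < δ → ∀ B : ℝ, ∃ C : ℝ, ∀ N : ℕ, 2 ≤ N → ∀ y r : ℕ → ℕ, (∀ d, y d ≤ N) → (∑ d ∈ Finset.Icc 1 ⌊(N : ℝ) ^ (1 - δ)⌋₊, |(∑ n ∈ (Finset.Icc 1 (y d)).filter (fun n : ℕ => n ≡ r d [MOD d]), ∏ h ∈ H, ArithmeticFunction.vonMangoldt (n + h)) - (if ∀ h ∈ H, Nat.Coprime (r d + h) d then (((Finset.range d).filter (fun ρ : ℕ => ∀ h ∈ H, Nat.Coprime (ρ + h) d)).card : ℝ)⁻¹ else 0) * ∑ n ∈ Finset.Icc 1 (y d), ∏ h ∈ H, ArithmeticFunction.vonMangoldt (n + h)|) ≤ C * N / Real.log N ^ B)) →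
    (∀ (H : Finset ℕ) (h : ℕ), 0 ∈ H → 2 ≤ H.card → h ∉ H → (∃ ε₀ : ℝ, 0 < ε₀ ∧ ∀ A : ℝ, 0 < A → ∃ C : ℝ, ∃ N₀ : ℕ, ∀ N : ℕ, N₀ ≤ N → ∀ w y : ℕ → ℕ, (∀ q, y q ≤ N) → (∑ q ∈ Finset.Icc 1 ⌊(N : ℝ) ^ ε₀⌋₊, |∑ n ∈ (Finset.Icc 1 (y q)).filter (fun n : ℕ => n ≡ w q [MOD q]), (ArithmeticFunction.liouville (n + h) : ℝ) * ∏ h' ∈ H, ArithmeticFunction.vonMangoldt (n + h')|) ≤ C * N / Real.log N ^ A)) →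
    ((∀ H : Finset ℕ, 0 ∈ H → 2 ≤ H.card → ((fun N : ℕ => ∑ n ∈ Finset.Icc 1 N, ∏ h ∈ H, ArithmeticFunction.vonMangoldt (n + h) - Literature.NumberTheory.Sieve.singularSeries ((H).image (fun h : ℕ => (h : ℤ))) * N) =o[Filter.atTop] fun N : ℕ => (N : ℝ))) → ∀ (t L : ℕ), 1 ≤ t → ∀ ε : ℝ, 0 < ε → ∃ N₀ : ℕ, ∀ N : ℕ, N₀ ≤ N → ∀ Ψ : Fin t → Literature.NumberTheory.Sieve.AffLinForm 1, Literature.NumberTheory.Sieve.IsNondegenerateSystem Ψ → Literature.NumberTheory.Sieve.affLinSize Ψ N ≤ L → ∀ K : Set (Fin 1 → ℝ), Convex ℝ K → K ⊆ Literature.NumberTheory.Sieve.realBox 1 N → |Literature.NumberTheory.Sieve.vonMangoldtSum Ψ K N - Literature.NumberTheory.Sieve.archFactor Ψ K * Literature.NumberTheory.Sieve.singularProduct Ψ| ≤ ε * (N : ℝ)) →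
    Summit.Parity.GeneralizedHardyLittlewood.Theses.LiouvilleMAD.EngineToGHL := by
  intro h1 h2 h3 h4
  refine EngineToGHL.engineToGHL_iff_pairsHL_imp_dimOne.mpr fun hP => h4 ?_
  suffices hs : ∀ t : ℕ, 2 ≤ t → ∀ H : Finset ℕ, 0 ∈ H → H.card = t → ((fun N : ℕ => ∑ n ∈ Finset.Icc 1 N, ∏ h ∈ H, ArithmeticFunction.vonMangoldt (n + h) - Literature.NumberTheory.Sieve.singularSeries ((H).image (fun h : ℕ => (h : ℤ))) * N) =o[Filter.atTop] fun N : ℕ => (N : ℝ)) from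
    fun H h0 hc => hs H.card hc H h0 rfl
  intro t ht
  induction t, ht using Nat.le_induction with
  | base => exact TupleLadder.hlTuple_pair_of_pairsHL hP
  | succ t ht ih =>
      exact h1 t ht ih (fun H h0 hc => h2 H h0 (hc ▸ ht))
        (fun H h h0 hc hh => h3 H h h0 (hc ▸ ht) hh)

/-- **The crux from the three conjecture-grade inputs** (rung discharged): relative tuple-EH `TupleLevel`, tuple
atoms `TupleAtoms` and the residual `TuplesToDimOne` imply `EngineToGHL`.  What remains open of the line is
exactly these three inputs (children 2–4 of the split). [folklore] -/
theorem engineToGHL_of_tupleInputs :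
    (∀ H : Finset ℕ, 0 ∈ H → 2 ≤ H.card → (∀ δ : ℝ, 0 < δ → ∀ B : ℝ, ∃ C : ℝ, ∀ N : ℕ, 2 ≤ N → ∀ y r : ℕ → ℕ, (∀ d, y d ≤ N) → (∑ d ∈ Finset.Icc 1 ⌊(N : ℝ) ^ (1 - δ)⌋₊, |(∑ n ∈ (Finset.Icc 1 (y d)).filter (fun n : ℕ => n ≡ r d [MOD d]), ∏ h ∈ H, ArithmeticFunction.vonMangoldt (n + h)) - (if ∀ h ∈ H, Nat.Coprime (r d + h) d then (((Finset.range d).filter (fun ρ : ℕ => ∀ h ∈ H, Nat.Coprime (ρ + h) d)).card : ℝ)⁻¹ else 0) * ∑ n ∈ Finset.Icc 1 (y d), ∏ h ∈ H, ArithmeticFunction.vonMangoldt (n + h)|) ≤ C * N / Real.log N ^ B)) →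
    (∀ (H : Finset ℕ) (h : ℕ), 0 ∈ H → 2 ≤ H.card → h ∉ H → (∃ ε₀ : ℝ, 0 < ε₀ ∧ ∀ A : ℝ, 0 < A → ∃ C : ℝ, ∃ N₀ : ℕ, ∀ N : ℕ, N₀ ≤ N → ∀ w y : ℕ → ℕ, (∀ q, y q ≤ N) → (∑ q ∈ Finset.Icc 1 ⌊(N : ℝ) ^ ε₀⌋₊, |∑ n ∈ (Finset.Icc 1 (y q)).filter (fun n : ℕ => n ≡ w q [MOD q]), (ArithmeticFunction.liouville (n + h) : ℝ) * ∏ h' ∈ H, ArithmeticFunction.vonMangoldt (n + h')|) ≤ C * N / Real.log N ^ A)) →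
    ((∀ H : Finset ℕ, 0 ∈ H → 2 ≤ H.card → ((fun N : ℕ => ∑ n ∈ Finset.Icc 1 N, ∏ h ∈ H, ArithmeticFunction.vonMangoldt (n + h) - Literature.NumberTheory.Sieve.singularSeries ((H).image (fun h : ℕ => (h : ℤ))) * N) =o[Filter.atTop] fun N : ℕ => (N : ℝ))) → ∀ (t L : ℕ), 1 ≤ t → ∀ ε : ℝ, 0 < ε → ∃ N₀ : ℕ, ∀ N : ℕ, N₀ ≤ N → ∀ Ψ : Fin t → Literature.NumberTheory.Sieve.AffLinForm 1, Literature.NumberTheory.Sieve.IsNondegenerateSystem Ψ → Literature.NumberTheory.Sieve.affLinSize Ψ N ≤ L → ∀ K : Set (Fin 1 → ℝ), Convex ℝ K → K ⊆ Literature.NumberTheory.Sieve.realBox 1 N → |Literature.NumberTheory.Sieve.vonMangoldtSum Ψ K N - Literature.NumberTheory.Sieve.archFactor Ψ K * Literature.NumberTheory.Sieve.singularProduct Ψ| ≤ ε * (N : ℝ)) →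
    Summit.Parity.GeneralizedHardyLittlewood.Theses.LiouvilleMAD.EngineToGHL :=
  engineToGHL_of_tupleLadder TupleLadder.tupleLadder_rung

/-- **`PairsHL`, `TupleLevel`, `TupleAtoms` ⊢ `EngineToGHL ↔ TuplesToDimOne`-direction bookkeeping: the residual
child is WEAKER than the crux** (so the split smuggles nothing upward): `EngineToGHL → (Tuples → DimOne)`, because
the tuples hypothesis contains `PairsHL` (`H = {0,k}`). [folklore] -/
theorem tuplesToDimOne_of_engineToGHL
    (hX : Summit.Parity.GeneralizedHardyLittlewood.Theses.LiouvilleMAD.EngineToGHL) :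
    (∀ H : Finset ℕ, 0 ∈ H → 2 ≤ H.card → ((fun N : ℕ => ∑ n ∈ Finset.Icc 1 N, ∏ h ∈ H, ArithmeticFunction.vonMangoldt (n + h) - Literature.NumberTheory.Sieve.singularSeries ((H).image (fun h : ℕ => (h : ℤ))) * N) =o[Filter.atTop] fun N : ℕ => (N : ℝ))) → ∀ (t L : ℕ), 1 ≤ t → ∀ ε : ℝ, 0 < ε → ∃ N₀ : ℕ, ∀ N : ℕ, N₀ ≤ N → ∀ Ψ : Fin t → Literature.NumberTheory.Sieve.AffLinForm 1, Literature.NumberTheory.Sieve.IsNondegenerateSystem Ψ → Literature.NumberTheory.Sieve.affLinSize Ψ N ≤ L → ∀ K : Set (Fin 1 → ℝ), Convex ℝ K → K ⊆ Literature.NumberTheory.Sieve.realBox 1 N → |Literature.NumberTheory.Sieve.vonMangoldtSum Ψ K N - Literature.NumberTheory.Sieve.archFactor Ψ K * Literature.NumberTheory.Sieve.singularProduct Ψ| ≤ ε * (N : ℝ) := by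
  intro hT
  refine EngineToGHL.engineToGHL_iff_pairsHL_imp_dimOne.mp hX ?_
  intro k hk
  have h0k : (0 : ℕ) ≠ k := by omega
  have himg : (({0, k} : Finset ℕ).image (fun h : ℕ => (h : ℤ))) = ({0, (k : ℤ)} : Finset ℤ) := by
    simp [Finset.image_insert, Finset.image_singleton]
  have hprod : ∀ n : ℕ, ∏ h ∈ ({0, k} : Finset ℕ), ArithmeticFunction.vonMangoldt (n + h) =
      ArithmeticFunction.vonMangoldt n * ArithmeticFunction.vonMangoldt (n + k) := by
    intro n
    rw [Finset.prod_pair h0k, Nat.add_zero]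
  have := hT ({0, k} : Finset ℕ) (by simp) (by rw [Finset.card_pair h0k])
  simpa only [hprod, himg] using this

end Summit.Parity.GeneralizedHardyLittlewood.Theorems.EngineToGHL
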